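/-
Copyright (c) 2026 the pub-hodgecm-mathlib formalisation cell (harness21).  Prover seat hodgecm-mathlib-F0P3a-p02 (g27), 2026-09-03.  Road M6 «ROW 2 ★ DYADIC TWIN» → F3
«TOT-Λ BY OVER-ORDERS» (LEAD F0P3a-plan T14-66 ∕ T15-08; WORD #77 queue), carve (c10b) «GATE AT b = 0» for the F3-5 pen (LH7-p04 (g12)); question of record 00:14:42Z,
LH4-p01 (g10) 00:20:46Z «the SIG-F3-3 §0 (UG-bdry) clause "gate at b = 0" is NOT typed anywhere».
-/
import Literature.NumberTheory.Automorphic.SelfDualCyclicOverOrderTorsor   -- ★ F3-2a (LH10-p01) p852941: `Λ_O(w)`, `mem_span_image_mulVec_iff`, the stratum count ∕ `…_eq_empty` (consumers of THIS file's heads)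
import Literature.NumberTheory.Automorphic.SelfDualLatticeTransport        -- ★ F3-2b FILE 1 (LH7-p04 (g11)): (T1) `eq_zero_of_map_mulVec_eq_zero`, `map_mul_mulVec`, (T2) `mem_span_range_transpose_iff_forall_dotProduct_mem`, `dotProduct_map_mulVec_eq`
import HarnessLib

/-!
# The gate at glue depth `b = 0`, necessity: a self-dual lattice cyclic for a PRODUCT over-order forces class I

Topic `NumberTheory/Automorphic`; namespace `Literature.NumberTheory.Automorphic`.  THEOREMS ONLY (no definition, no instance, no notation, no named fact, no `sorry`);
kernel lane `--supports stmt-HodgeConjecture-24833`.  Cell `pub/hodgecm-mathlib` (D-0151), crux H413 = `stmt-HodgeConjecture-24833`; road M6 → F3 «TOT-Λ by over-orders»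
(route (B)): the F3-5 assembly (LH7-p04 (g12) F3-5a `OverOrderStrataTotal`, LH10-p01 (g10) ★ (c14) `GluedFamilyReindex`) discharges, per stratum `G(N″, b, c′)`, a verdict
`hgood` (a witness self-dual cyclic lattice, feeding ★ F3-2a `ncard_setOf_selfDual_cyclicOver_eq_relIndex`'s `hb₀`) or `hbad` (the stratum is empty, ★ F3-2a
`setOf_selfDual_cyclicOver_eq_empty`'s `hno`).  For `b ≥ 1` both come from ★ (UG)'s DEEP unitary generator and the ★ F4 gates (+ ★ (c8)); at the BOUNDARY `b = 0` — the
PRODUCT over-orders `G₀(N″) = 𝒪_E × O_{N″}`, which have no deep unitary generator — neither F4 head instantiates (SIG-F3-3 §0 (UG-bdry): «gate at `b = 0`: good iff class I —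
the `E`-line summand must be self-dual on its own»).  THIS FILE proves the NECESSITY half (the `hbad` supplier at `b = 0`) in ★ F3-2a ∕ ★ F3-2b's endoscopic-carrier currency
VERBATIM (`B = E × K`, `φ : B →ₐ[E] M_n(E)` injective with `φ τ_B = τ`, `τ` regular with cyclic vector `w₀`, adjoint `b ↦ b⋆ := (σ b₁, σ_K b₂)` with
`hstar : J·φ(b⋆) = σ(φ b)ᵀ·J`, an over-order `O ≤ B` containing the scalars): **if `O` contains the idempotent `e₁ = (1, 0)` (i.e. `O = pr₁ O × pr₂ O` is a PRODUCT order) with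
integral first coordinates, and some `Λ_O(φ(b) w₀)` (`b ∈ B^×`) is self-dual (`= Λ(u)`, `u ∈ U(σ, J)`), then `|σ(b₁)·b₁·⟨x₀, x₀⟩| = 1`** for the `E`-eigenline vector
`x₀ := φ(e₁)·w₀` (`⟨x₀, x₀⟩ := σ(x₀)ᵀ J x₀`) — so `⟨x₀, x₀⟩` is a norm times a unit («class I»; in `ℤ`-valued currency: `log|⟨x₀,x₀⟩|` is even).  Contrapositive = the `hno` of ★
F3-2a `setOf_selfDual_cyclicOver_eq_empty` at every product over-order in class II.  Any `n` (the consumer has `n = 3`); no `2`, no `d`, no parity binder, no discreteness.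
HONEST LABEL: HC_CM is proved only modulo the 7 printed citations (2 remaining named inputs: hLiu418 = stmt-HodgeConjecture-24832, h413 = stmt-HodgeConjecture-24833) until
rung 0 closes; elementary lattice algebra over a valuation ring, asserts nothing printed; count-neutral (zero label movement until F5 ★ and a desk-priced rider).  The
SUFFICIENCY half at `b = 0` (a witness in class I: `E`-line `ϖ^{−m}x₀` ⊥ a self-dual `O_{N″}`-cyclic line in the `K`-plane, whose parity is tied to class I by `J ∈ GL₃(𝒪)`)
is NOT in this file.

THE MATHEMATICS.  Write `P(m, m′) := σ(φ(m)w₀)ᵀ J (φ(m′)w₀)` (`m, m′ ∈ B`); `hstar` gives the ADJOINT `P(bm, m′) = P(m, b⋆m′)`, so for `x ∈ O` and `y ∈ E`: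
`P(xb, y·e₁) = y·σ(x₁b₁)·⟨x₀, x₀⟩` (`(xb)⋆e₁ = σ(x₁b₁)·e₁`, `e₁⋆ = e₁ = e₁²`).  Let `Λ = Λ_O(φ(b)w₀) = {φ(xb)w₀ : x ∈ O}` be self-dual.  MEMBERSHIP: `y·x₀ = φ(y e₁)w₀ ∈ Λ`
iff `y e₁ b⁻¹ = (y∕b₁, 0) ∈ O` iff `y∕b₁ ∈ 𝒪` (cyclicity of `w₀`, injectivity of `φ`; `(t, 0) = t·e₁ ∈ O` iff `t ∈ 𝒪`).  SELF-DUALITY IN MEMBERSHIP FORM (★ (T2)): `y·x₀ ∈ Λ`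
iff `P(Λ, y·x₀) ⊆ 𝒪`.  With `y := b₁` (so `y∕b₁ = 1`): `σ(b₁)b₁⟨x₀,x₀⟩ = P(e₁ b, b₁x₀) ∈ 𝒪`, i.e. `|s| ≤ 1` for `s := σ(b₁)b₁⟨x₀,x₀⟩`.  If `|s| < 1`: for `s ≠ 0` take
`y := b₁∕s`, then `P(xb, y·x₀) = σ(x₁) ∈ 𝒪` for every `x ∈ O`, so `y·x₀ ∈ Λ`, i.e. `1∕s ∈ 𝒪` — impossible; for `s = 0` take `y := b₁∕ϖ` (`ϖ` a non-unit), then all pairings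
vanish, so `1∕ϖ ∈ 𝒪` — impossible.  Hence `|s| = 1`.  [cite: Jacobowitz1962, §4, §7] [cite: Serre1980Trees, Ch. II §1.1] [cite: Rogawski1990, §4.9 Lemma 4.9.3 p. 56]

* §1 `pairing_adjoint`, `star_mul_idem_fst`, `pairing_mul_smul_idem_fst` (the adjoint and the `E`-line pairing formula).
* §2 `smul_idem_fst_mem_span_image_iff` (membership of `y·x₀`), **`valuation_norm_fst_mul_pairing_eq_one_of_selfDual_cyclicOver`** (the gate, necessity),
  **`not_exists_selfDual_cyclicOver_of_forall_valuation_ne_one`** (the `hno` form for ★ F3-2a `setOf_selfDual_cyclicOver_eq_empty`).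

## References
* [Jacobowitz1962] R. Jacobowitz, *Hermitian forms over local fields*, Amer. J. Math. 84 (1962): §4 (dual lattices; a unimodular line `𝒪v` has `⟨v, v⟩` a unit), §7.
* [Serre1980Trees] J.-P. Serre, *Trees* (1980): Ch. II §1.1 (lattices over valuation rings).
* [Rogawski1990] J. D. Rogawski, *Automorphic Representations of Unitary Groups in Three Variables*, Ann. of Math. Stud. 123 (1990): §4.9 Lemma 4.9.3 p. 56, Prop. 4.9.1 (b)
  p. 55 (where the self-dual lattice counts are consumed).
* [Neukirch1999] J. Neukirch, *Algebraic Number Theory*, Grundlehren 322 (1999): Ch. I §12 (orders; product ∕ fibre-product orders).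
-/

set_option autoImplicit false

noncomputable section

open Matrix
open scoped MatrixGroups ValuativeRel

namespace Literature.NumberTheory.Automorphic

open Literature.NumberTheory.Automorphic.UnitaryGroup

section ProductGate

variable {E : Type*} [Field E] [ValuativeRel E] {n : ℕ} (σ : E →+* E) {K : Type*} [Field K] [Algebra E K] (σK : K →+* K)
  (hσO : ∀ x : 𝒪[E], σ x ∈ 𝒪[E])
  (J : GL (Fin n) E) (hJ : J ∈ glInt n E)
  (τ : Matrix (Fin n) (Fin n) E) {w₀ : Fin n → E} (hK : IsUnit (Matrix.of fun i j : Fin n => ((τ ^ (j : ℕ)) *ᵥ w₀) i).det)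
  (φ : (E × K) →ₐ[E] Matrix (Fin n) (Fin n) E) (hφ : Function.Injective φ) (τB : E × K) (hτB : φ τB = τ)
  (hstar : ∀ b : E × K, (J : Matrix (Fin n) (Fin n) E) * φ (RingHom.prodMap σ σK b) = ((φ b).map σ)ᵀ * J)
  (O : Subring (E × K)) (hO : ∀ r : 𝒪[E], algebraMap E (E × K) (r : E) ∈ O)

/-! ## §1 The pairing `P(m, m′) = σ(φ(m)w₀)ᵀ J φ(m′)w₀`: adjoint, and its values against the `E`-line `y·x₀` -/

omit [ValuativeRel E] in
include hstar in
/-- **ADJOINT**: `P(b·m, m′) = P(m, b⋆·m′)` for `P(m, m′) := σ(φ(m)w₀)ᵀ J (φ(m′)w₀)` and `b⋆ = (σ b₁, σ_K b₂)` (`hstar`). [cite: Jacobowitz1962, §4] -/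
theorem pairing_adjoint (b m m' : E × K) :
    dotProduct (fun i => σ ((φ (b * m) *ᵥ w₀) i)) ((J : Matrix (Fin n) (Fin n) E) *ᵥ (φ m' *ᵥ w₀)) =
      dotProduct (fun i => σ ((φ m *ᵥ w₀) i)) ((J : Matrix (Fin n) (Fin n) E) *ᵥ (φ (RingHom.prodMap σ σK b * m') *ᵥ w₀)) := by
  rw [map_mul_mulVec φ b m, map_mul_mulVec φ (RingHom.prodMap σ σK b) m', dotProduct_map_mulVec_eq]
  simp only [Matrix.mulVec_mulVec, ← Matrix.mul_assoc]
  rw [← hstar b]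

omit [ValuativeRel E] in
/-- `(x·b)⋆·e₁ = σ(x₁ b₁)·e₁` for the idempotent `e₁ = (1, 0)` of `E × K`. [cite: Neukirch1999, Ch. I §12] -/
theorem star_mul_idem_fst (x b : E × K) :
    RingHom.prodMap σ σK (x * b) * ((1, 0) : E × K) = σ (x.1 * b.1) • ((1, 0) : E × K) := by
  ext <;> simp

omit [ValuativeRel E] in
/-- `y·x₀ = φ(y·e₁)·w₀` for `x₀ = φ(e₁)·w₀` (`φ` is `E`-linear). [cite: HornJohnson2013, §3.2.4] -/
theorem smul_mulVec_idem_eq (y : E) (e : E × K) : y • (φ e *ᵥ w₀) = φ (y • e) *ᵥ w₀ := by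
  rw [map_smul, Matrix.smul_mulVec]

omit [ValuativeRel E] in
include hstar in
/-- **THE `E`-LINE PAIRING FORMULA**: `P(x·b, y·e₁) = y·σ(x₁b₁)·⟨x₀, x₀⟩`, `x₀ = φ(e₁)w₀`, `⟨x₀, x₀⟩ = σ(x₀)ᵀ J x₀` (adjoint, `(xb)⋆e₁ = σ(x₁b₁)e₁`, `e₁⋆ = e₁ = e₁²`).
[cite: Jacobowitz1962, §4] -/
theorem pairing_mul_smul_idem_fst (x b : E × K) (y : E) :
    dotProduct (fun i => σ ((φ (x * b) *ᵥ w₀) i)) ((J : Matrix (Fin n) (Fin n) E) *ᵥ (y • (φ ((1, 0) : E × K) *ᵥ w₀))) =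
      y * σ (x.1 * b.1) * dotProduct (fun i => σ ((φ ((1, 0) : E × K) *ᵥ w₀) i)) ((J : Matrix (Fin n) (Fin n) E) *ᵥ (φ ((1, 0) : E × K) *ᵥ w₀)) := by
  set e₁ : E × K := (1, 0) with he₁
  -- `⟨x₀, x₀⟩ = P(1, e₁)` (`e₁⋆ e₁ = e₁`)
  have hstar1 : RingHom.prodMap σ σK e₁ * e₁ = e₁ := by ext <;> simp [he₁]
  have hd : dotProduct (fun i => σ ((φ e₁ *ᵥ w₀) i)) ((J : Matrix (Fin n) (Fin n) E) *ᵥ (φ e₁ *ᵥ w₀)) =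
      dotProduct (fun i => σ ((φ (1 : E × K) *ᵥ w₀) i)) ((J : Matrix (Fin n) (Fin n) E) *ᵥ (φ e₁ *ᵥ w₀)) := by
    have h := pairing_adjoint σ σK J φ (w₀ := w₀) hstar e₁ 1 e₁
    rw [mul_one, hstar1] at h
    exact h
  -- `P(xb, y e₁) = P(1, (xb)⋆ (y e₁)) = y σ(x₁b₁) P(1, e₁)`
  have h1 : y • (φ e₁ *ᵥ w₀) = φ (y • e₁) *ᵥ w₀ := smul_mulVec_idem_eq φ y e₁
  have h2 := pairing_adjoint σ σK J φ (w₀ := w₀) hstar (x * b) 1 (y • e₁)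
  rw [mul_one] at h2
  have h3 : RingHom.prodMap σ σK (x * b) * (y • e₁) = (y * σ (x.1 * b.1)) • e₁ := by
    rw [mul_smul_comm, star_mul_idem_fst σ σK x b, smul_smul]
  rw [h1, h2, h3, ← smul_mulVec_idem_eq φ, Matrix.mulVec_smul, dotProduct_smul, smul_eq_mul, hd]

/-! ## §2 The gate at `b = 0`, necessity -/

include hK hφ hτB hO in
/-- **MEMBERSHIP OF THE `E`-LINE**: for a product over-order (`e₁ ∈ O`, integral first coordinates) and `b ∈ B^×`:
`y·x₀ ∈ Λ_O(φ(b)w₀) ⟺ y·b₁⁻¹ ∈ 𝒪` (`y x₀ = φ(y e₁)w₀`; cyclicity of `w₀` and injectivity of `φ` read `φ(xb)w₀ = φ(ye₁)w₀` as `x = y e₁ b⁻¹ = (y∕b₁, 0)`).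
[cite: Serre1980Trees, Ch. II §1.1] [cite: HornJohnson2013, §3.2.4] -/
theorem smul_idem_fst_mem_span_image_iff (he₁ : ((1, 0) : E × K) ∈ O) (hOfst : ∀ x ∈ O, x.1 ∈ 𝒪[E]) (b : (E × K)ˣ) (y : E) :
    y • (φ ((1, 0) : E × K) *ᵥ w₀) ∈ Submodule.span 𝒪[E] ((fun b' : E × K => φ b' *ᵥ (φ (b : E × K) *ᵥ w₀)) '' (O : Set (E × K))) ↔
      y * ((b : E × K).1)⁻¹ ∈ 𝒪[E] := by
  set e₁ : E × K := (1, 0) with he₁def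
  have hb1 : ((b : E × K).1) * ((↑b⁻¹ : E × K).1) = 1 := by
    have h := congrArg Prod.fst b.mul_inv
    rwa [Prod.fst_mul, Prod.fst_one] at h
  have hb10 : (b : E × K).1 ≠ 0 := fun h0 => by rw [h0, zero_mul] at hb1; exact zero_ne_one hb1
  have hinv1 : (↑b⁻¹ : E × K).1 = ((b : E × K).1)⁻¹ := (eq_inv_of_mul_eq_one_right hb1)
  -- `(y e₁) b⁻¹ = (y / b₁, 0) = (y b₁⁻¹) • e₁`
  have hprod : (y • e₁) * (↑b⁻¹ : E × K) = (y * ((b : E × K).1)⁻¹) • e₁ := by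
    rw [← hinv1]; ext <;> simp [he₁def]
  -- `(t, 0) ∈ O ↔ t ∈ 𝒪`
  have hline : ∀ t : E, t • e₁ ∈ O ↔ t ∈ 𝒪[E] := by
    intro t
    constructor
    · intro h
      have := hOfst _ h
      simpa [he₁def] using this
    · intro ht
      have h : t • e₁ = algebraMap E (E × K) t * e₁ := Algebra.smul_def t e₁
      rw [h]
      exact O.mul_mem (hO ⟨t, ht⟩) he₁
  rw [mem_span_image_mulVec_iff φ O hO, ← hline, ← hprod]
  constructor
  · rintro ⟨x, hx, hxe⟩
    have hxb : x * (b : E × K) = y • e₁ := by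
      have h0 : φ (x * (b : E × K) - y • e₁) *ᵥ w₀ = 0 := by
        rw [map_sub, Matrix.sub_mulVec, map_mul_mulVec, hxe, smul_mulVec_idem_eq φ, sub_self]
      exact sub_eq_zero.1 (eq_zero_of_map_mulVec_eq_zero τ hK φ hφ τB hτB h0)
    have : x = (y • e₁) * (↑b⁻¹ : E × K) := by rw [← hxb, mul_assoc, Units.mul_inv, mul_one]
    rw [← this]; exact hx
  · intro h
    refine ⟨(y • e₁) * (↑b⁻¹ : E × K), h, ?_⟩
    rw [← map_mul_mulVec, mul_assoc, Units.inv_mul, mul_one, smul_mulVec_idem_eq φ]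

include hσO hJ hK hφ hτB hstar hO in
/-- **THE GATE AT `b = 0`, NECESSITY: a self-dual lattice cyclic for a PRODUCT over-order forces `|σ(b₁) b₁ ⟨x₀, x₀⟩| = 1`.**  `O ≤ E × K` an over-order containing
the scalars and the idempotent `e₁ = (1, 0)` (a product order `𝒪_E × O_{N″}`), with integral first coordinates; if `Λ_O(φ(b) w₀) = Λ(u)` for some `b ∈ B^×`, `u ∈ U(σ, J)`
(`J ∈ GL_n(𝒪)`), then `σ(b₁)·b₁·⟨x₀, x₀⟩` is a UNIT, `x₀ = φ(e₁)w₀`, `⟨x₀, x₀⟩ = σ(x₀)ᵀ J x₀` — the `E`-line summand `𝒪·b₁x₀` of the (orthogonally split) lattice is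
self-dual on its own, so `⟨x₀, x₀⟩ ∈ N(E^×)·𝒪^×`: CLASS I.  (`ϖ` = any non-zero non-unit, used only to refute `⟨x₀, x₀⟩ = 0`.)
[cite: Jacobowitz1962, §4, §7] [cite: Serre1980Trees, Ch. II §1.1] [cite: Rogawski1990, §4.9 Lemma 4.9.3 p. 56] -/
theorem valuation_norm_fst_mul_pairing_eq_one_of_selfDual_cyclicOver (he₁ : ((1, 0) : E × K) ∈ O) (hOfst : ∀ x ∈ O, x.1 ∈ 𝒪[E])
    {ϖ : E} (hϖ0 : ϖ ≠ 0) (hϖ1 : ValuativeRel.valuation E ϖ < 1) (b : (E × K)ˣ)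
    (hb : ∃ u ∈ unitaryGroupOfForm σ (J : Matrix (Fin n) (Fin n) E),
      Submodule.span 𝒪[E] ((fun b' : E × K => φ b' *ᵥ (φ (b : E × K) *ᵥ w₀)) '' (O : Set (E × K))) =
        Submodule.span 𝒪[E] (Set.range ((u : Matrix (Fin n) (Fin n) E))ᵀ)) :
    ValuativeRel.valuation E (σ (b : E × K).1 * (b : E × K).1 *
      dotProduct (fun i => σ ((φ ((1, 0) : E × K) *ᵥ w₀) i)) ((J : Matrix (Fin n) (Fin n) E) *ᵥ (φ ((1, 0) : E × K) *ᵥ w₀))) = 1 := by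
  obtain ⟨u, hu, hΛ⟩ := hb
  set e₁ : E × K := (1, 0) with he₁def
  set x₀ : Fin n → E := φ e₁ *ᵥ w₀ with hx₀
  set d₀ : E := dotProduct (fun i => σ (x₀ i)) ((J : Matrix (Fin n) (Fin n) E) *ᵥ x₀) with hd₀
  set b₁ : E := (b : E × K).1 with hb₁
  set s : E := σ b₁ * b₁ * d₀ with hs
  have hb1 : b₁ * ((↑b⁻¹ : E × K).1) = 1 := by
    have h := congrArg Prod.fst b.mul_inv
    rwa [Prod.fst_mul, Prod.fst_one] at h
  have hb10 : b₁ ≠ 0 := fun h0 => by rw [h0, zero_mul] at hb1; exact zero_ne_one hb1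
  -- membership of `y x₀` in `Λ`, read through (T2)
  have hmem : ∀ y : E, y • x₀ ∈ Submodule.span 𝒪[E] (Set.range ((u : Matrix (Fin n) (Fin n) E))ᵀ) ↔ y * b₁⁻¹ ∈ 𝒪[E] := fun y => by
    rw [← hΛ]; exact smul_idem_fst_mem_span_image_iff τ hK φ hφ τB hτB O hO he₁ hOfst b y
  have hT2 : ∀ y : E, (∀ m ∈ Submodule.span 𝒪[E] ((fun b' : E × K => φ b' *ᵥ (φ (b : E × K) *ᵥ w₀)) '' (O : Set (E × K))),
      dotProduct (fun i => σ (m i)) ((J : Matrix (Fin n) (Fin n) E) *ᵥ (y • x₀)) ∈ 𝒪[E]) → y * b₁⁻¹ ∈ 𝒪[E] := by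
    intro y h
    rw [← hmem, mem_span_range_transpose_iff_forall_dotProduct_mem σ hσO J hJ hu]
    rw [← hΛ]
    exact h
  -- the pairing against `Λ = {φ(xb)w₀ : x ∈ O}`
  have hpair : ∀ (x : E × K) (y : E), dotProduct (fun i => σ ((φ (x * (b : E × K)) *ᵥ w₀) i)) ((J : Matrix (Fin n) (Fin n) E) *ᵥ (y • x₀)) =
      y * σ (x.1 * b₁) * d₀ := fun x y => pairing_mul_smul_idem_fst σ σK J φ hstar x (b : E × K) y
  have hall : ∀ y : E, (∀ x ∈ O, y * σ (x.1 * b₁) * d₀ ∈ 𝒪[E]) → y * b₁⁻¹ ∈ 𝒪[E] := by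
    intro y h
    refine hT2 y fun m hm => ?_
    obtain ⟨x, hx, rfl⟩ := (mem_span_image_mulVec_iff φ O hO _ _).1 hm
    rw [← map_mul_mulVec, hpair]
    exact h x hx
  -- `|s| ≤ 1`: `b₁ x₀ ∈ Λ`, test against `φ(e₁ b) w₀ ∈ Λ`
  have hle : s ∈ 𝒪[E] := by
    have hyx : b₁ • x₀ ∈ Submodule.span 𝒪[E] (Set.range ((u : Matrix (Fin n) (Fin n) E))ᵀ) := by
      rw [hmem, mul_inv_cancel₀ hb10]; exact Subring.one_mem _
    rw [mem_span_range_transpose_iff_forall_dotProduct_mem σ hσO J hJ hu, ← hΛ] at hyx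
    have hm : φ e₁ *ᵥ (φ (b : E × K) *ᵥ w₀) ∈ Submodule.span 𝒪[E] ((fun b' : E × K => φ b' *ᵥ (φ (b : E × K) *ᵥ w₀)) '' (O : Set (E × K))) :=
      (mem_span_image_mulVec_iff φ O hO _ _).2 ⟨e₁, he₁, rfl⟩
    have h := hyx _ hm
    rw [← map_mul_mulVec, hpair] at h
    have he1 : e₁.1 = 1 := rfl
    have he : b₁ * σ (e₁.1 * b₁) * d₀ = s := by rw [he1, one_mul, hs]; ring
    rwa [he] at h
  -- `|s| ≥ 1`
  rcases eq_or_ne s 0 with hs0 | hs0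
  · -- `d₀ = 0`: every pairing with the `E`-line vanishes, so `(b₁/ϖ) x₀ ∈ Λ`, i.e. `ϖ⁻¹ ∈ 𝒪` — absurd
    exfalso
    have hd0 : d₀ = 0 := by
      have hσb : σ b₁ ≠ 0 := (map_ne_zero σ).2 hb10
      rw [hs] at hs0
      rcases mul_eq_zero.1 hs0 with h | h
      · rcases mul_eq_zero.1 h with h' | h'
        · exact absurd h' hσb
        · exact absurd h' hb10
      · exact h
    have h := hall (b₁ * ϖ⁻¹) fun x _ => by rw [hd0, mul_zero]; exact Subring.zero_mem _
    rw [mul_assoc, mul_comm ϖ⁻¹, ← mul_assoc, mul_inv_cancel₀ hb10, one_mul, Valuation.mem_integer_iff, map_inv₀] at h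
    exact (lt_irrefl _) (lt_of_lt_of_le ((one_lt_inv₀ ((Valuation.pos_iff _).2 hϖ0)).2 hϖ1) h)
  · -- `s ≠ 0`: with `y := b₁/s` every pairing is `σ(x₁) ∈ 𝒪`, so `s⁻¹ ∈ 𝒪`; with `|s| ≤ 1` this gives `|s| = 1`
    have h := hall (b₁ * s⁻¹) fun x hx => by
      have hx1 : σ x.1 ∈ 𝒪[E] := hσO ⟨x.1, hOfst x hx⟩
      have : b₁ * s⁻¹ * σ (x.1 * b₁) * d₀ = σ x.1 * (s * s⁻¹) := by rw [map_mul, hs]; ring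
      rw [this, mul_inv_cancel₀ hs0, mul_one]
      exact hx1
    rw [mul_assoc, mul_comm s⁻¹, ← mul_assoc, mul_inv_cancel₀ hb10, one_mul] at h
    have h1 : ValuativeRel.valuation E s ≤ 1 := (Valuation.mem_integer_iff _ _).1 hle
    have h2 : ValuativeRel.valuation E s⁻¹ ≤ 1 := (Valuation.mem_integer_iff _ _).1 h
    rw [map_inv₀] at h2
    have hpos : 0 < ValuativeRel.valuation E s := (Valuation.pos_iff _).2 hs0
    exact le_antisymm h1 ((inv_le_one₀ hpos).1 h2)

include hσO hJ hK hφ hτB hstar hO in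
/-- **THE `hno` FORM (class II ⇒ the product-order stratum is empty)**: if `⟨x₀, x₀⟩` is NOT a norm times a unit — `|σ(c)·c·⟨x₀, x₀⟩| ≠ 1` for every `c ≠ 0` — then no
`b ∈ B^×` has `Λ_O(φ(b) w₀)` self-dual, for any product over-order `O` (`e₁ ∈ O`, integral first coordinates): the hypothesis `hno` of ★ F3-2a
`setOf_selfDual_cyclicOver_eq_empty`, token for token. [cite: Jacobowitz1962, §7] [cite: Rogawski1990, §4.9 Lemma 4.9.3 p. 56] -/
theorem not_exists_selfDual_cyclicOver_of_forall_valuation_ne_one (he₁ : ((1, 0) : E × K) ∈ O) (hOfst : ∀ x ∈ O, x.1 ∈ 𝒪[E])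
    {ϖ : E} (hϖ0 : ϖ ≠ 0) (hϖ1 : ValuativeRel.valuation E ϖ < 1)
    (hII : ∀ c : E, c ≠ 0 → ValuativeRel.valuation E (σ c * c *
      dotProduct (fun i => σ ((φ ((1, 0) : E × K) *ᵥ w₀) i)) ((J : Matrix (Fin n) (Fin n) E) *ᵥ (φ ((1, 0) : E × K) *ᵥ w₀))) ≠ 1) :
    ∀ b : (E × K)ˣ, ¬ ∃ u ∈ unitaryGroupOfForm σ (J : Matrix (Fin n) (Fin n) E),
      Submodule.span 𝒪[E] ((fun b' : E × K => φ b' *ᵥ (φ (b : E × K) *ᵥ w₀)) '' (O : Set (E × K))) =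
        Submodule.span 𝒪[E] (Set.range ((u : Matrix (Fin n) (Fin n) E))ᵀ) := by
  intro b hb
  have hb1 : (b : E × K).1 * ((↑b⁻¹ : E × K).1) = 1 := by
    have h := congrArg Prod.fst b.mul_inv
    rwa [Prod.fst_mul, Prod.fst_one] at h
  have hb10 : (b : E × K).1 ≠ 0 := fun h0 => by rw [h0, zero_mul] at hb1; exact zero_ne_one hb1
  exact hII _ hb10 (valuation_norm_fst_mul_pairing_eq_one_of_selfDual_cyclicOver σ σK hσO J hJ τ hK φ hφ τB hτB hstar O hO he₁ hOfst hϖ0 hϖ1 b hb)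

end ProductGate

/-! ## §3 The necessity half in the F3-5 pen's letters: `O = incl(S)`, any `E`-line vector `x₀`, conclusion `Even (log |⟨x₀, x₀⟩_J|)` -/

section Parity

open scoped _root_.WithZero

variable {E : Type*} [Field E] [Valued E ℤᵐ⁰] [ValuativeRel E] [(Valued.v : Valuation E ℤᵐ⁰).Compatible] {n : ℕ} (σ : E →+* E)
  {K : Type*} [Field K] [ValuativeRel K] [Algebra E K] (σK : K →+* K)
  (hσO : ∀ x : 𝒪[E], σ x ∈ 𝒪[E])
  (J : GL (Fin n) E) (hJ : J ∈ glInt n E)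
  (τ : Matrix (Fin n) (Fin n) E) {w₀ : Fin n → E} (hK : IsUnit (Matrix.of fun i j : Fin n => ((τ ^ (j : ℕ)) *ᵥ w₀) i).det)
  (φ : (E × K) →ₐ[E] Matrix (Fin n) (Fin n) E) (hφ : Function.Injective φ) (τB : E × K) (hτB : φ τB = τ)
  (hstar : ∀ b : E × K, (J : Matrix (Fin n) (Fin n) E) * φ (RingHom.prodMap σ σK b) = ((φ b).map σ)ᵀ * J)

omit [Valued E ℤᵐ⁰] [ValuativeRel E] [(Valued.v : Valuation E ℤᵐ⁰).Compatible] in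
/-- The gate's token `⟨x, x⟩_J = Σ_k Σ_i σ(x_i) J_{ik} x_k` is the pairing `σ(x)ᵀ (J x)`. [cite: Jacobowitz1962, §4] -/
theorem sum_sum_eq_dotProduct_mulVec (x : Fin n → E) :
    ∑ k, ∑ i, σ (x i) * (J : Matrix (Fin n) (Fin n) E) i k * x k = dotProduct (fun i => σ (x i)) ((J : Matrix (Fin n) (Fin n) E) *ᵥ x) := by
  simp only [dotProduct, Matrix.mulVec, Finset.mul_sum]
  rw [Finset.sum_comm]
  exact Finset.sum_congr rfl fun i _ => Finset.sum_congr rfl fun k _ => by ring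

omit [Valued E ℤᵐ⁰] [ValuativeRel E] [(Valued.v : Valuation E ℤᵐ⁰).Compatible] in
/-- Sesquilinearity on a line: `⟨c·x, c·x⟩ = σ(c)·c·⟨x, x⟩`. [cite: Jacobowitz1962, §4] -/
theorem dotProduct_mulVec_smul_smul (c : E) (x : Fin n → E) :
    dotProduct (fun i => σ ((c • x) i)) ((J : Matrix (Fin n) (Fin n) E) *ᵥ (c • x)) =
      σ c * c * dotProduct (fun i => σ (x i)) ((J : Matrix (Fin n) (Fin n) E) *ᵥ x) := by
  have h : (fun i => σ ((c • x) i)) = σ c • fun i => σ (x i) := by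
    funext i; simp only [Pi.smul_apply, smul_eq_mul, map_mul]
  rw [h, smul_dotProduct, Matrix.mulVec_smul, dotProduct_smul, smul_eq_mul, smul_eq_mul, mul_assoc]

omit [ValuativeRel K] in
/-- `Valued.v x = 1` from `valuation E x = 1` (the two valuations are compatible with the same valuative relation). [cite: Serre1980Trees, Ch. II §1.1] -/
theorem valued_v_eq_one_of_valuation_eq_one {x : E} (hx : ValuativeRel.valuation E x = 1) : Valued.v x = 1 := by
  have hle : ∀ a b : E, Valued.v a ≤ Valued.v b ↔ ValuativeRel.valuation E a ≤ ValuativeRel.valuation E b := fun a b => by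
    rw [← Valuation.vle_iff_le (Valued.v : Valuation E ℤᵐ⁰), Valuation.vle_iff_le (ValuativeRel.valuation E)]
  have h1 := (hle x 1).2 (by rw [hx, map_one])
  have h2 := (hle 1 x).2 (by rw [hx, map_one])
  rw [map_one] at h1 h2
  exact le_antisymm h1 h2

include hσO hJ hK hφ hτB hstar in
/-- **THE GATE AT `b = 0`, NECESSITY, IN THE F3-5 PEN'S LETTERS (LH7-p04 (g12) 00:24:06Z).**  `O := incl(S)` for a subring `S ≤ 𝒪_E × 𝒪_K` containing the idempotent
`(1, 0)` (every product order `G(N″, 0, c′)` does, ★ (c10) §0) and the scalars (`hO`, ★ F3-2a's binder at `O := S.map incl`); `x₀` ANY non-zero vector of the `E`-line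
`range φ(1, 0)`; `σ` valuation-preserving.  If SOME `Λ_O(w)` is self-dual, then **`log|⟨x₀, x₀⟩_J|` is EVEN** (`⟨x₀, x₀⟩_J = Σ_k Σ_i σ(x₀ᵢ) J_{ik} x₀ₖ`, the ★ F4 gate's token) —
★ F3-2a `exists_units_of_mem_over` puts the lattice in the form `Λ_O(φ(b)w₀)`, §2 gives `|σ(b₁)b₁⟨x₀′,x₀′⟩| = 1` for `x₀′ = φ(1,0)w₀`, and `x₀ = c·x₀′`. Contrapositive: in
class II (odd `log`) the product-order stratum is empty. [cite: Jacobowitz1962, §7] [cite: Rogawski1990, §4.9 Lemma 4.9.3 p. 56, Prop. 4.9.1 (b) p. 55] -/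
theorem even_log_pairing_of_exists_selfDual_cyclicOver_map (hσv : ∀ x, Valued.v (σ x) = Valued.v x)
    (S : Subring (𝒪[E] × 𝒪[K])) (he₁S : ((1, 0) : 𝒪[E] × 𝒪[K]) ∈ S)
    (hO : ∀ r : 𝒪[E], algebraMap E (E × K) (r : E) ∈ S.map (RingHom.prodMap (𝒪[E]).subtype (𝒪[K]).subtype))
    {ϖ : E} (hϖ : IsUniformizingElement ϖ) (x₀ : Fin n → E) (hx₀ : ∃ v : Fin n → E, φ ((1, 0) : E × K) *ᵥ v = x₀) (hx₀0 : x₀ ≠ 0)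
    (h : ∃ w : Fin n → E, ∃ g ∈ unitaryGroupOfForm σ (J : Matrix (Fin n) (Fin n) E),
      Submodule.span 𝒪[E] ((fun x : E × K => φ x *ᵥ w) '' (S.map (RingHom.prodMap (𝒪[E]).subtype (𝒪[K]).subtype) : Set (E × K))) =
        Submodule.span 𝒪[E] (Set.range ((g : Matrix (Fin n) (Fin n) E))ᵀ)) :
    Even (WithZero.log (Valued.v (∑ k, ∑ i, σ (x₀ i) * (J : Matrix (Fin n) (Fin n) E) i k * x₀ k))) := by
  set O : Subring (E × K) := S.map (RingHom.prodMap (𝒪[E]).subtype (𝒪[K]).subtype) with hOdef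
  set e₁ : E × K := (1, 0) with he₁def
  set x₀' : Fin n → E := φ e₁ *ᵥ w₀ with hx₀'
  have he₁ : e₁ ∈ O := Subring.mem_map.2 ⟨(1, 0), he₁S, by simp [he₁def]⟩
  have hOfst : ∀ x ∈ O, x.1 ∈ 𝒪[E] := fun x hx => by
    obtain ⟨z, -, rfl⟩ := Subring.mem_map.1 hx
    exact z.1.2
  -- the self-dual lattice in the form `Λ_O(φ(b) w₀)`
  obtain ⟨w, g, hg, hΛ⟩ := h
  obtain ⟨b, hb, -⟩ := exists_units_of_mem_over σ J τ hK φ hφ τB hτB O hO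
    (Λ := Submodule.span 𝒪[E] ((fun x : E × K => φ x *ᵥ w) '' (O : Set (E × K)))) ⟨⟨g, hg, hΛ⟩, w, rfl⟩
  have hval := valuation_norm_fst_mul_pairing_eq_one_of_selfDual_cyclicOver σ σK hσO J hJ τ hK φ hφ τB hτB hstar O hO he₁ hOfst
    hϖ.ne_zero hϖ.valuation_lt_one b hb
  -- `x₀ = c • x₀'`
  obtain ⟨v, hv⟩ := hx₀
  obtain ⟨m, hm⟩ := exists_map_mulVec_eq τ hK φ τB hτB v
  have hx₀c : x₀ = m.1 • x₀' := by
    rw [← hv, ← hm, ← map_mul_mulVec, hx₀', smul_mulVec_idem_eq φ]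
    congr 2
    ext <;> simp [he₁def]
  have hc0 : m.1 ≠ 0 := fun h0 => hx₀0 (by rw [hx₀c, h0, zero_smul])
  -- valuations
  set b₁ : E := (b : E × K).1 with hb₁
  set d₀ : E := dotProduct (fun i => σ (x₀' i)) ((J : Matrix (Fin n) (Fin n) E) *ᵥ x₀') with hd₀
  have hv1 : Valued.v (σ b₁ * b₁ * d₀) = 1 := valued_v_eq_one_of_valuation_eq_one hval
  have hb10 : b₁ ≠ 0 := fun h0 => by rw [h0, mul_zero, zero_mul, map_zero] at hv1; exact zero_ne_one hv1
  have hd00 : d₀ ≠ 0 := fun h0 => by rw [h0, mul_zero, map_zero] at hv1; exact zero_ne_one hv1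
  have hB : Valued.v b₁ ≠ 0 := (Valuation.ne_zero_iff _).2 hb10
  have hA : Valued.v m.1 ≠ 0 := (Valuation.ne_zero_iff _).2 hc0
  have hD : Valued.v d₀ ≠ 0 := (Valuation.ne_zero_iff _).2 hd00
  rw [sum_sum_eq_dotProduct_mulVec, hx₀c, dotProduct_mulVec_smul_smul, map_mul, map_mul, hσv,
    WithZero.log_mul (mul_ne_zero hA hA) hD, WithZero.log_mul hA hA]
  rw [map_mul, map_mul, hσv] at hv1
  have hlog := congrArg WithZero.log hv1
  rw [WithZero.log_mul (mul_ne_zero hB hB) hD, WithZero.log_mul hB hB, WithZero.log_one] at hlog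
  exact ⟨WithZero.log (Valued.v m.1) - WithZero.log (Valued.v b₁), by omega⟩

end Parity

end Literature.NumberTheory.Automorphic

end
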